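import Literature.Computability.QuantumComplexity.PolyCopiesIdx
import Literature.Computability.QuantumComplexity.StageChains
import HarnessLib

/-!
# Sequential chains of a circuit family, I: layout, programs, the family, and the state after the stages

Topic `Literature/Computability/QuantumComplexity`. The circuit-level form of *adaptive sequential
composition* of a quantum subroutine with classical control — "run the machine, measure its
register, compute the next input from the outcome, run it again", `T(n)` times (Bernstein–Vazirani
1997, §8: classical control and subroutine calls inside quantum machines; Nielsen–Chuang 2010, §4.4:
by the principle of deferred measurement the intermediate measurements may be replaced by `CNOT`
copies onto fresh wires, all measurements being postponed to the end). Given a circuit family `S`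
and polynomials `T` (number of stages) and `m` (window width), the **chain family** on inputs `x` of
length `n` has a front window of `Bw(n)` wires (holding `x`) and `T(n)` blocks of `Bw(n)` wires; for
`k < T(n)`, stage `k`

1. assembles in block `k` the stage input `⟨x, ⟨1ᵏ, y_k⟩⟩` (`StageChains.stageInput`; `CNOT` copies
   of the bits of `x` from the front window, `NOT`s for the constant bits of the pairing, and — for
   `k ≥ 1` — `CNOT` copies of the first `m(n)` wires of block `k-1`, the window `y_k`),
2. swaps block `k` with the front window, runs `S.circ ℓ_k` VERBATIM on the front wires
   (`ℓ_k = |⟨x, ⟨1ᵏ, y_k⟩⟩|`), and swaps back (the conjugation trick of `PolyCopies.lean`, so that the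
   description of the chain family contains the descriptions of the stages verbatim),

and a final swap brings the last block to the front, so that the last stage's measured register is
a PREFIX of the measured register of the chain family. Proved here (Parts I–III): the layout and the
programs with their classical semantics, the circuits and the family, oracle-freeness, and **the
state after `k` stages** (`stateAfter`: a "Markov product" of the stage amplitudes — block `j < k`
carries the amplitude of `S.circ ℓ_j` from the input assembled out of `x` and the content of block
`j-1` to its own content, `runOn_stages`), the final swap, and the output kernel as the Born sum of that
state (`kernelProb_family_eq`). The output LAW (the measured last block follows
`chainLaw A S m x T`, whence the prefix inequality `hLoop` of `Cryptography/RegevMainTheoremStages.lean`)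
is `SeqChainLaw.lean`; uniformity is `SeqChainUniform.lean`.

## References

* E. Bernstein, U. Vazirani, *Quantum complexity theory*, SIAM J. Comput. 26 (1997), §8.2–8.3
  [BernsteinVazirani1997].
* M. A. Nielsen, I. L. Chuang, *Quantum Computation and Quantum Information*, CUP 2010, §1.3.4
  (swap from three `CNOT`s), §3.2.5, §4.3 (`U ⊗ 1`), §4.4 (principle of deferred measurement)
  [NielsenChuang2010].
* C. H. Bennett, E. Bernstein, G. Brassard, U. Vazirani, *Strengths and weaknesses of quantum
  computing*, SIAM J. Comput. 26 (1997), proof of Thm. 4.14 (subroutine calls on computed inputs)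
  [BennettBernsteinBrassardVazirani1997].
* S. Arora, B. Barak, *Computational Complexity: A Modern Approach*, CUP 2009, §10.3.7 Lemma 10.10
  [AroraBarak2009].
-/

noncomputable section

namespace Literature.Computability.QuantumComplexity

namespace SeqChain

open _root_.Computability Complexity Cryptography RevSim RevMux Function Matrix Finset

/-! ## Part I. Layout and programs -/

/-- **Parameters of a chain family**: the stage family `S` with a polynomial bound of its ancilla
count, the number of stages `T` and the window width `m` as polynomials of the input length.
[cite: BernsteinVazirani1997, §8.2 (polynomially many subroutine calls)] -/
structure Params where
  /-- the stage family -/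
  S : QCircuitFamily cliffordT
  /-- a polynomial bound of its ancilla count -/
  pS : Polynomial ℕ
  /-- the bound -/
  hpS : ∀ n, S.ancillas n ≤ pS.eval n
  /-- the number of stages, as a polynomial of the input length -/
  T : Polynomial ℕ
  /-- the window width, as a polynomial of the input length -/
  m : Polynomial ℕ

variable (P : Params)

/-! ### Layout -/

/-- The number of stages on inputs of length `n`. [folklore] -/
def Tn (n : ℕ) : ℕ := P.T.eval n

/-- The window width on inputs of length `n`. [folklore] -/
def mn (n : ℕ) : ℕ := P.m.eval n

/-- The length of the window handed to stage `k`: `0` for the first stage, `m(n)` afterwards. [folklore] -/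
def yl (n k : ℕ) : ℕ := if k = 0 then 0 else mn P n

/-- **The input length of stage `k`**: `|⟨x, ⟨1ᵏ, y_k⟩⟩| = 2n + 2k + 4 + |y_k|`. [folklore] -/
def il (n k : ℕ) : ℕ := 2 * n + 2 * k + 4 + yl P n k

/-- A common bound of the stage input lengths (`k < T(n)`). [folklore] -/
def Lmax (n : ℕ) : ℕ := 2 * n + 2 * Tn P n + 4 + mn P n

/-- **The block width** (= the width of the front window): room for every stage register, for the
window, and for the input. [folklore] -/
def Bw (n : ℕ) : ℕ := Lmax P n + P.pS.eval (Lmax P n) + 1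

/-- The first wire of the blocks. [folklore] -/
def base (n : ℕ) : ℕ := Bw P n

/-- Wire `i` of block `k`. [folklore] -/
def blk (n k i : ℕ) : ℕ := base P n + k * Bw P n + i

/-- The total number of wires. [folklore] -/
def W (n : ℕ) : ℕ := base P n + Tn P n * Bw P n

/-- The number of ancillas. [folklore] -/
def anc (n : ℕ) : ℕ := W P n - n

/-- The register width of stage `k`: input plus ancillas of the stage family (reducible, so that
the register of `S.circ (il n k)` IS `QReg (rl n k)`). [folklore] -/
abbrev rl (n k : ℕ) : ℕ := il P n k + P.S.ancillas (il P n k)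

/-! ### Size bookkeeping -/

section Sizes

variable {P}

/-- Evaluation of a polynomial with natural coefficients is monotone. [folklore] -/
theorem eval_mono_nat (p : Polynomial ℕ) {a b : ℕ} (h : a ≤ b) : p.eval a ≤ p.eval b := by
  simp only [Polynomial.eval_eq_sum_range]
  exact Finset.sum_le_sum fun i _ => Nat.mul_le_mul_left _ (Nat.pow_le_pow_left h i)

/-- `yl n k ≤ m n`. [folklore] -/
theorem yl_le (n k : ℕ) : yl P n k ≤ mn P n := by unfold yl; split_ifs <;> omega

/-- `yl n 0 = 0`. [folklore] -/
@[simp] theorem yl_zero (n : ℕ) : yl P n 0 = 0 := by simp [yl]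

/-- `yl n (k+1) = m n`. [folklore] -/
@[simp] theorem yl_succ (n k : ℕ) : yl P n (k + 1) = mn P n := by simp [yl]

/-- The stage input lengths are bounded by `Lmax` (for `k < T n`). [folklore] -/
theorem il_le_Lmax {n k : ℕ} (hk : k < Tn P n) : il P n k ≤ Lmax P n := by
  have := yl_le (P := P) n k; unfold il Lmax; omega

/-- **Every stage register fits into a block**: `rl n k < Bw n` for `k < T n`. [folklore] -/
theorem rl_lt_Bw {n k : ℕ} (hk : k < Tn P n) : rl P n k < Bw P n := by
  have h1 := il_le_Lmax (P := P) hk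
  have h2 : P.S.ancillas (il P n k) ≤ P.pS.eval (Lmax P n) :=
    (P.hpS _).trans (eval_mono_nat P.pS h1)
  unfold rl Bw; omega

/-- `rl n k ≤ Bw n` for `k < T n`. [folklore] -/
theorem rl_le_Bw {n k : ℕ} (hk : k < Tn P n) : rl P n k ≤ Bw P n := (rl_lt_Bw hk).le

/-- The input length of a stage is below its register width. [folklore] -/
theorem il_le_rl (n k : ℕ) : il P n k ≤ rl P n k := Nat.le_add_right _ _

/-- The window fits into a block: `m n < Bw n`. [folklore] -/
theorem mn_lt_Bw (n : ℕ) : mn P n < Bw P n := by unfold Bw Lmax; omega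

/-- The input fits into the front window: `n < Bw n`. [folklore] -/
theorem lt_Bw (n : ℕ) : n < Bw P n := by unfold Bw Lmax; omega

/-- `0 < Bw n`. [folklore] -/
theorem Bw_pos (n : ℕ) : 0 < Bw P n := by unfold Bw; omega

/-- `base ≤ W`. [folklore] -/
theorem base_le_W (n : ℕ) : base P n ≤ W P n := by unfold W; exact Nat.le_add_right _ _

/-- `blk n k i = blk n k 0 + i`. [folklore] -/
theorem blk_eq_add (n k i : ℕ) : blk P n k i = blk P n k 0 + i := by unfold blk; omega

/-- Wires of block `k < T n` are below `W`. [folklore] -/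
theorem blk_lt_W {n k i : ℕ} (hk : k < Tn P n) (hi : i < Bw P n) : blk P n k i < W P n := by
  unfold blk W base
  have : k * Bw P n + i < Tn P n * Bw P n := by
    calc k * Bw P n + i < k * Bw P n + Bw P n := by omega
      _ = (k + 1) * Bw P n := by ring
      _ ≤ Tn P n * Bw P n := Nat.mul_le_mul_right _ hk
  omega

/-- Blocks are disjoint: equal wires have equal block and offset. [folklore] -/
theorem blk_inj {n k i k' i' : ℕ} (hi : i < Bw P n) (hi' : i' < Bw P n) (h : blk P n k i = blk P n k' i') :
    k = k' ∧ i = i' := by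
  unfold blk at h
  have h1 : k * Bw P n + i = k' * Bw P n + i' := by omega
  have hk : k = k' := by nlinarith
  subst hk
  exact ⟨rfl, by omega⟩

/-- `base ≤ blk`. [folklore] -/
theorem base_le_blk (n k i : ℕ) : base P n ≤ blk P n k i := by unfold blk; omega

/-- Front wires are below every block wire. [folklore] -/
theorem lt_blk_of_lt_Bw {n p : ℕ} (hp : p < Bw P n) (k i : ℕ) : p < blk P n k i :=
  lt_of_lt_of_le hp (base_le_blk n k i)

/-- `n ≤ W n`. [folklore] -/
theorem le_W (n : ℕ) : n ≤ W P n := (lt_Bw n).le.trans (base_le_W n)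

/-- **`n + anc n = W n`.** [folklore] -/
theorem n_add_anc (n : ℕ) : n + anc P n = W P n := by have := le_W (P := P) n; unfold anc; omega

/-- There is a wire. [folklore] -/
theorem width_pos (n : ℕ) : 0 < n + anc P n := by
  rw [n_add_anc]; exact lt_of_lt_of_le (Bw_pos n) (base_le_W n)

/-- Consecutive blocks: `blk n k 0 + Bw n = blk n (k+1) 0`. [folklore] -/
theorem blk_succ (n k : ℕ) : blk P n (k + 1) 0 = blk P n k 0 + Bw P n := by unfold blk; ring

end Sizes

/-! ### The programs -/

/-- The positions of the constant `1`s of `⟨x, ⟨1ᵏ, y⟩⟩ = x̃ 01 1^{2k} 01 y`: `2n+1`, `2n+2 … 2n+1+2k`,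
`2n+2k+3`. [cite: AroraBarak2009, §0.1 (pairing of strings)] -/
def onesPos (n k : ℕ) : List ℕ :=
  (2 * n + 1) :: ((List.range (2 * k)).map fun j => 2 * n + 2 + j) ++ [2 * n + 2 * k + 3]

/-- **The positions written by the input assembly of stage `k`**: the `2n` doubled bits of `x`, the
constant ones, and the `|y_k|` window bits (positions `2n+2k+4, …`). [folklore] -/
def posAll (n k : ℕ) : List ℕ :=
  List.range (2 * n) ++ onesPos n k ++ (List.range (yl P n k)).map fun j => 2 * n + 2 * k + 4 + j

/-- **The operation writing position `q` of the stage input into block `k`**: a `CNOT` from front wire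
`⌊q/2⌋` (a doubled bit of `x`), a `NOT` (a constant one of the pairing pattern), or a `CNOT` from wire
`q - (2n+2k+4)` of block `k-1` (a window bit: deferred measurement — the previous register is copied,
not measured). [cite: NielsenChuang2010, §1.3.4 (CNOT copies classical bits), §4.4 (deferred measurement)] -/
def mkOp (n k q : ℕ) : ClOp ℕ :=
  if q < 2 * n then ClOp.cnot (q / 2) (blk P n k q)
  else if q < 2 * n + 2 * k + 4 then ClOp.not (blk P n k q)
  else ClOp.cnot (blk P n (k - 1) (q - (2 * n + 2 * k + 4))) (blk P n k q)

/-- **The input assembly program of stage `k`.** [cite: BennettBernsteinBrassardVazirani1997, Thm. 4.14 (proof: the input of the next call is computed from the previous answers)] -/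
def progIn (n k : ℕ) : List (ClOp ℕ) := (posAll P n k).map (mkOp P n k)

/-- The pairs (front wire `i`, wire `i` of block `k`), `i < Bw n`. [folklore] -/
def conjPairs (n k : ℕ) : List (ℕ × ℕ) := (List.range (Bw P n)).map fun i => (i, blk P n k i)

/-- **The conjugating swap of block `k` with the front window.** [cite: NielsenChuang2010, §1.3.4 (swap from three CNOTs)] -/
def progConj (n k : ℕ) : List (ClOp ℕ) := swapOps (conjPairs P n k)

/-! ### Positions -/

section Pos

variable {P}

/-- The positions of the ones lie in `(2n, 2n + 2k + 4)`. [folklore] -/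
theorem mem_onesPos_bounds {n k p : ℕ} (hp : p ∈ onesPos n k) : 2 * n < p ∧ p < 2 * n + 2 * k + 4 := by
  simp only [onesPos, List.cons_append, List.mem_cons, List.mem_append, List.mem_map, List.mem_range,
    List.not_mem_nil, or_false] at hp
  rcases hp with rfl | ⟨j, hj, rfl⟩ | rfl <;> omega

/-- Membership in the positions of the ones. [folklore] -/
theorem mem_onesPos_iff {n k p : ℕ} :
    p ∈ onesPos n k ↔ p = 2 * n + 1 ∨ (2 * n + 2 ≤ p ∧ p < 2 * n + 2 * k + 2) ∨ p = 2 * n + 2 * k + 3 := by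
  simp only [onesPos, List.cons_append, List.mem_cons, List.mem_append, List.mem_map, List.mem_range,
    List.not_mem_nil, or_false]
  constructor
  · rintro (rfl | ⟨j, hj, rfl⟩ | rfl)
    · exact Or.inl rfl
    · exact Or.inr (Or.inl ⟨by omega, by omega⟩)
    · exact Or.inr (Or.inr rfl)
  · rintro (rfl | ⟨h1, h2⟩ | rfl)
    · exact Or.inl rfl
    · exact Or.inr (Or.inl ⟨p - (2 * n + 2), by omega, by omega⟩)
    · exact Or.inr (Or.inr rfl)

/-- **The written positions are strictly increasing** (hence without duplicates). [folklore] -/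
theorem pairwise_lt_posAll (n k : ℕ) : (posAll P n k).Pairwise (· < ·) := by
  have hones : (onesPos n k).Pairwise (· < ·) := by
    unfold onesPos
    rw [List.cons_append, List.pairwise_cons, List.pairwise_append]
    refine ⟨fun p hp => ?_, ?_, List.pairwise_singleton _ _, ?_⟩
    · simp only [List.mem_append, List.mem_map, List.mem_range, List.mem_singleton] at hp
      rcases hp with ⟨j, -, rfl⟩ | rfl <;> omega
    · exact (List.pairwise_lt_range.map _ fun a b h => by omega)
    · intro p hp q hq
      simp only [List.mem_map, List.mem_range, List.mem_singleton] at hp hq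
      obtain ⟨j, hj, rfl⟩ := hp
      subst hq; omega
  unfold posAll
  rw [List.pairwise_append, List.pairwise_append]
  refine ⟨⟨List.pairwise_lt_range, hones, fun p hp q hq => ?_⟩,
    List.pairwise_lt_range.map _ (fun a b h => by omega), fun p hp q hq => ?_⟩
  · rw [List.mem_range] at hp
    exact hp.trans (mem_onesPos_bounds hq).1
  · simp only [List.mem_map, List.mem_range] at hq
    obtain ⟨j, -, rfl⟩ := hq
    rcases List.mem_append.1 hp with hp | hp
    · rw [List.mem_range] at hp; omega
    · have := (mem_onesPos_bounds hp).2; omega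

/-- The written positions have no duplicates. [folklore] -/
theorem nodup_posAll (n k : ℕ) : (posAll P n k).Nodup :=
  (pairwise_lt_posAll n k).imp fun h => Nat.ne_of_lt h

/-- Written positions are below the stage input length. [folklore] -/
theorem lt_il_of_mem_posAll {n k q : ℕ} (hq : q ∈ posAll P n k) : q < il P n k := by
  unfold posAll at hq; unfold il
  rcases List.mem_append.1 hq with hq | hq
  · rcases List.mem_append.1 hq with hq | hq
    · rw [List.mem_range] at hq; omega
    · have := (mem_onesPos_bounds hq).2; omega
  · simp only [List.mem_map, List.mem_range] at hq
    obtain ⟨j, hj, rfl⟩ := hq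
    omega

/-- **Which positions below the input length are written**: all but the two separator zeros `2n`
and `2n + 2k + 2`. [cite: AroraBarak2009, §0.1 (pairing of strings)] -/
theorem mem_posAll_iff {n k q : ℕ} (hq : q < il P n k) :
    q ∈ posAll P n k ↔ q ≠ 2 * n ∧ q ≠ 2 * n + 2 * k + 2 := by
  unfold il at hq
  unfold posAll
  simp only [List.mem_append, List.mem_range, List.mem_map, mem_onesPos_iff]
  constructor
  · rintro ((h | h) | ⟨j, hj, rfl⟩) <;> omega
  · rintro ⟨h1, h2⟩
    by_cases hq2 : q < 2 * n
    · exact Or.inl (Or.inl hq2)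
    by_cases hq3 : q < 2 * n + 2 * k + 4
    · exact Or.inl (Or.inr (by omega))
    · exact Or.inr ⟨q - (2 * n + 2 * k + 4), by omega, by omega⟩

end Pos

/-! ### Membership, well-formedness and wire bounds -/

section WF

variable {P}

/-- The target of `mkOp n k q` is wire `q` of block `k`. [folklore] -/
@[simp] theorem target_mkOp (n k q : ℕ) : (mkOp P n k q).target = blk P n k q := by
  unfold mkOp; split_ifs <;> rfl

/-- The targets of the assembly program. [folklore] -/
theorem map_target_progIn (n k : ℕ) : (progIn P n k).map ClOp.target = (posAll P n k).map fun q => blk P n k q := by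
  rw [progIn, List.map_map]
  exact List.map_congr_left fun q _ => target_mkOp n k q

/-- **The targets of the assembly program have no duplicates.** [folklore] -/
theorem nodup_target_progIn (n k : ℕ) : ((progIn P n k).map ClOp.target).Nodup := by
  rw [map_target_progIn]
  exact (nodup_posAll n k).map fun a b h => by unfold blk at h; omega

/-- Membership in the assembly program. [folklore] -/
theorem mem_progIn {n k : ℕ} {op : ClOp ℕ} : op ∈ progIn P n k ↔ ∃ q ∈ posAll P n k, op = mkOp P n k q := by
  simp only [progIn, List.mem_map]
  exact ⟨fun ⟨q, hq, h⟩ => ⟨q, hq, h.symm⟩, fun ⟨q, hq, h⟩ => ⟨q, hq, h.symm⟩⟩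

/-- The controls of `mkOp n k q`: a front wire below `n`, nothing, or a window wire of block `k-1`. [folklore] -/
theorem controls_mkOp (n k q : ℕ) : (mkOp P n k q).controls =
    if q < 2 * n then [q / 2] else if q < 2 * n + 2 * k + 4 then []
    else [blk P n (k - 1) (q - (2 * n + 2 * k + 4))] := by
  unfold mkOp; split_ifs <;> rfl

/-- Stage input lengths are inside the block (for `k < T n`). [folklore] -/
theorem il_lt_Bw {n k : ℕ} (hk : k < Tn P n) : il P n k < Bw P n :=
  lt_of_le_of_lt (il_le_rl n k) (rl_lt_Bw hk)

/-- A window position is a position of a nonzero stage. [folklore] -/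
theorem k_pos_of_window {n k q : ℕ} (hq : q < il P n k) (h : ¬ q < 2 * n + 2 * k + 4) : 0 < k := by
  by_contra hk
  have hk0 : k = 0 := by omega
  subst hk0
  unfold il at hq; rw [yl_zero] at hq; omega

/-- **No target of the assembly program is one of its controls.** [folklore] -/
theorem progIn_disjoint {n k : ℕ} (hk : k < Tn P n) :
    ∀ op ∈ progIn P n k, ∀ op' ∈ progIn P n k, op'.target ∉ op.controls := by
  intro op hop op' hop'
  obtain ⟨q, hq, rfl⟩ := mem_progIn.1 hop
  obtain ⟨q', hq', rfl⟩ := mem_progIn.1 hop'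
  rw [target_mkOp, controls_mkOp]
  have hqil := lt_il_of_mem_posAll hq
  split_ifs with h1 h2
  · simp only [List.mem_singleton]
    intro e
    have : q / 2 < Bw P n := lt_of_lt_of_le (by omega) (lt_Bw n).le
    exact absurd e (Nat.ne_of_gt (lt_blk_of_lt_Bw this k q'))
  · simp
  · simp only [List.mem_singleton]
    intro e
    have hkpos := k_pos_of_window hqil h2
    have hj : q - (2 * n + 2 * k + 4) < Bw P n := by
      have := il_lt_Bw (P := P) hk; omega
    have hq'B : q' < Bw P n := (lt_il_of_mem_posAll hq').trans (il_lt_Bw hk)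
    have := (blk_inj hq'B hj e).1
    omega

/-- `progIn` is well formed. [folklore] -/
theorem progIn_wf {n k : ℕ} (hk : k < Tn P n) : ∀ op ∈ progIn P n k, op.WF := by
  intro op hop
  have h := progIn_disjoint hk op hop op hop
  obtain ⟨q, -, rfl⟩ := mem_progIn.1 hop
  revert h
  unfold mkOp
  split_ifs <;> simp [ClOp.WF, ClOp.target, ClOp.controls, eq_comm]

/-- `progIn` uses wires below `W`. [folklore] -/
theorem progIn_lt {n k : ℕ} (hk : k < Tn P n) : ∀ op ∈ progIn P n k, ∀ p ∈ wiresOf op, p < W P n := by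
  intro op hop p hp
  obtain ⟨q, hq, rfl⟩ := mem_progIn.1 hop
  have hqB : q < Bw P n := (lt_il_of_mem_posAll hq).trans (il_lt_Bw hk)
  rw [mem_wiresOf, target_mkOp, controls_mkOp] at hp
  rcases hp with rfl | hp
  · exact blk_lt_W hk hqB
  · split_ifs at hp with h1 h2
    · rw [List.mem_singleton] at hp; subst hp
      exact lt_of_lt_of_le (by omega) (le_W n)
    · exact absurd hp List.not_mem_nil
    · rw [List.mem_singleton] at hp; subst hp
      have hkpos := k_pos_of_window (lt_il_of_mem_posAll hq) h2
      refine blk_lt_W (by omega) ?_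
      have := il_lt_Bw (P := P) hk; unfold il at this; omega

/-- `progConj` is well formed. [folklore] -/
theorem progConj_wf (n k : ℕ) : ∀ op ∈ progConj P n k, op.WF := by
  refine swapOps_wf fun p hp => ?_
  simp only [conjPairs, List.mem_map, List.mem_range] at hp
  obtain ⟨i, hi, rfl⟩ := hp
  exact Nat.ne_of_lt (lt_blk_of_lt_Bw hi k i)

/-- `progConj n k` uses wires below `W` (for `k < T n`). [folklore] -/
theorem progConj_lt {n k : ℕ} (hk : k < Tn P n) : ∀ op ∈ progConj P n k, ∀ p ∈ wiresOf op, p < W P n := by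
  intro op hop p hp
  obtain ⟨q, hq, h⟩ := CWrap.wiresOf_swapOps hop p hp
  simp only [conjPairs, List.mem_map, List.mem_range] at hq
  obtain ⟨i, hi, rfl⟩ := hq
  rcases h with rfl | rfl
  · exact lt_of_lt_of_le hi (base_le_W n)
  · exact blk_lt_W hk hi

end WF

/-! ## Part II. Classical semantics of the programs -/

section Semantics

variable {P}

/-- **The source bit of position `q`** on the assignment `w`: the guard of `mkOp n k q` — the front bit
`⌊q/2⌋`, the constant `1`, or the window bit of block `k-1`. [folklore] -/
def srcBit (P : Params) (n k : ℕ) (w : ℕ → Bool) (q : ℕ) : Bool :=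
  if q < 2 * n then w (q / 2) else if q < 2 * n + 2 * k + 4 then true
  else w (blk P n (k - 1) (q - (2 * n + 2 * k + 4)))

/-- The guard of `mkOp` is the source bit. [folklore] -/
theorem guard_mkOp (n k q : ℕ) (w : ℕ → Bool) : (mkOp P n k q).guard w = srcBit P n k w q := by
  unfold mkOp srcBit; split_ifs <;> rfl

/-- **The stage input read off an assignment**: `⟨x, ⟨1ᵏ, y⟩⟩` with `x` the first `n` front bits and
`y` the window of block `k-1` (empty for `k = 0`), as a bit table (default `0`). [folklore] -/
def inBits (P : Params) (n k : ℕ) (w : ℕ → Bool) (q : ℕ) : Bool :=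
  (stageInput (List.ofFn fun i : Fin n => w i) k (List.ofFn fun j : Fin (yl P n k) => w (blk P n (k - 1) j))).getD q false

/-- Reading a `List.ofFn` with default. [folklore] -/
theorem getD_ofFn {N : ℕ} (f : Fin N → Bool) (i : ℕ) :
    (List.ofFn f).getD i false = if h : i < N then f ⟨i, h⟩ else false := by
  split_ifs with h
  · rw [List.getD_eq_getElem _ _ (by simpa using h), List.getElem_ofFn]
  · rw [List.getD_eq_default _ _ (by simpa using Nat.not_lt.1 h)]

/-- **The stage input bit table in terms of source bits**: at a written position the source bit, at
the two separator zeros and beyond the input length `0`. [cite: AroraBarak2009, §0.1 (pairing of strings)] -/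
theorem inBits_eq (n k : ℕ) (w : ℕ → Bool) (q : ℕ) :
    inBits P n k w q = if q ∈ posAll P n k then srcBit P n k w q else false := by
  unfold inBits
  rw [getD_stageInput, List.length_ofFn, getD_ofFn, getD_ofFn]
  by_cases hq : q < il P n k
  · have hiff := mem_posAll_iff (P := P) hq
    unfold il at hq
    unfold srcBit
    by_cases hmem : q ∈ posAll P n k
    · rw [if_pos hmem]
      obtain ⟨hne1, hne2⟩ := hiff.1 hmem
      by_cases h1 : q < 2 * n
      · rw [if_pos h1, dif_pos (by omega), if_pos h1]
      rw [if_neg h1, if_neg h1, if_neg hne1]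
      by_cases h3 : q < 2 * n + 2 * k + 2
      · rw [if_pos h3, if_pos (by omega)]
      rw [if_neg h3, if_neg hne2]
      by_cases h5 : q = 2 * n + 2 * k + 3
      · rw [if_pos h5, if_pos (by omega)]
      rw [if_neg h5, if_neg (by omega), dif_pos (by omega)]
    · rw [if_neg hmem]
      have hor : q = 2 * n ∨ q = 2 * n + 2 * k + 2 := by
        by_contra hcon
        exact hmem (hiff.2 ⟨fun h => hcon (Or.inl h), fun h => hcon (Or.inr h)⟩)
      rcases hor with rfl | rfl
      · rw [if_neg (lt_irrefl _), if_pos rfl]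
      · rw [if_neg (by omega), if_neg (by omega), if_neg (lt_irrefl _), if_pos rfl]
  · have hmem : q ∉ posAll P n k := fun h => hq (lt_il_of_mem_posAll h)
    rw [if_neg hmem]
    unfold il at hq
    rw [if_neg (by omega), if_neg (by omega), if_neg (by omega), if_neg (by omega), if_neg (by omega),
      dif_neg (by omega)]

/-- **The assembly program writes the stage input into block `k`** (XOR onto what was there).
[cite: BennettBernsteinBrassardVazirani1997, Thm. 4.14 (proof: inputs of the calls are computed classically)] -/
theorem clEval_progIn_blk {n k : ℕ} (hk : k < Tn P n) (w : ℕ → Bool) (q : ℕ) :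
    clEval (progIn P n k) w (blk P n k q) = (w (blk P n k q) ^^ inBits P n k w q) := by
  rw [inBits_eq]
  by_cases hq : q ∈ posAll P n k
  · rw [if_pos hq]
    have hop : mkOp P n k q ∈ progIn P n k := mem_progIn.2 ⟨q, hq, rfl⟩
    have h := clEval_apply_target_of_nodup _ (progIn_disjoint hk) (nodup_target_progIn n k) w hop
    rw [target_mkOp, guard_mkOp] at h
    exact h
  · rw [if_neg hq, Bool.xor_false]
    refine clEval_apply_of_forall_target_ne _ _ fun op hop => ?_
    obtain ⟨q', hq', rfl⟩ := mem_progIn.1 hop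
    rw [target_mkOp]
    intro e
    have : q' = q := by unfold blk at e; omega
    exact hq (this ▸ hq')

/-- **The assembly program does not touch wires outside block `k`.** [folklore] -/
theorem clEval_progIn_of_ne {n k : ℕ} (w : ℕ → Bool) {p : ℕ} (hp : ∀ q, q < il P n k → p ≠ blk P n k q) :
    clEval (progIn P n k) w p = w p :=
  clEval_apply_of_forall_target_ne _ _ fun op hop => by
    obtain ⟨q, hq, rfl⟩ := mem_progIn.1 hop
    rw [target_mkOp]
    exact (hp q (lt_il_of_mem_posAll hq)).symm

/-- **A program whose targets are never controls undoes itself.** [cite: NielsenChuang2010, §3.2.5 (reversible gates are their own inverses)] -/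
theorem clEval_clEval_of_disjoint {ι : Type*} [DecidableEq ι] (ops : List (ClOp ι))
    (h : ∀ op ∈ ops, ∀ op' ∈ ops, op'.target ∉ op.controls) (w : ι → Bool) :
    clEval ops (clEval ops w) = w := by
  funext i
  rw [clEval_apply_of_disjoint ops h, clEval_apply_of_disjoint ops h,
    clToggle_congr ops i (w := clEval ops w) (w' := w)]
  · cases w i <;> cases clToggle ops w i <;> rfl
  · intro op hop c hc
    exact clEval_apply_of_forall_target_ne ops w fun op' hop' e => h op hop op' hop' (e ▸ hc)

/-- The assembly program undoes itself. [folklore] -/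
theorem clEval_progIn_progIn {n k : ℕ} (hk : k < Tn P n) (w : ℕ → Bool) :
    clEval (progIn P n k) (clEval (progIn P n k) w) = w :=
  clEval_clEval_of_disjoint _ (progIn_disjoint hk) w

end Semantics

/-! ## Part II (continued). The circuits and the family -/

section Compile

variable {P}

/-- `progIn` fits. [folklore] -/
theorem progIn_lt' {n k : ℕ} (hk : k < Tn P n) : ∀ op ∈ progIn P n k, ∀ i ∈ wiresOf op, i < n + anc P n := by
  rw [n_add_anc]; exact progIn_lt hk

/-- `progConj n k` fits (for `k < T n`). [folklore] -/
theorem progConj_lt' {n k : ℕ} (hk : k < Tn P n) : ∀ op ∈ progConj P n k, ∀ i ∈ wiresOf op, i < n + anc P n := by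
  rw [n_add_anc]; exact progConj_lt hk

/-- The stage register fits into the register (for `k < T n`). [folklore] -/
theorem rl_fits {n k : ℕ} (hk : k < Tn P n) : rl P n k ≤ n + anc P n := by
  rw [n_add_anc]; exact (rl_le_Bw hk).trans (base_le_W n)

/-- The front window fits into the register. [folklore] -/
theorem Bw_le_width (n : ℕ) : Bw P n ≤ n + anc P n := by
  rw [n_add_anc]; exact base_le_W n

variable (P)

/-- A program over `ℕ` with wires below `n + anc n`, re-indexed to `Fin (n + anc n)` and turned into
reversible operations. [cite: AroraBarak2009, §10.3.7 Lemma 10.10] -/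
def clamp (n : ℕ) (ops : List (ClOp ℕ)) (hlt : ∀ op ∈ ops, ∀ i ∈ wiresOf op, i < n + anc P n)
    (hwf : ∀ op ∈ ops, op.WF) : List (RevOp (n + anc P n)) :=
  toRevList (ops.map (ClOp.map (finOf (n + anc P n) (width_pos n)))) fun op hop => by
    simp only [List.mem_map] at hop
    obtain ⟨op, hop, rfl⟩ := hop
    exact wf_map_finOf _ (hlt op hop) (hwf op hop)

/-- **Semantics of a clamped program**: the `ℕ`-program on the lifted assignment. [folklore] -/
theorem revEval_clamp (n : ℕ) (ops : List (ClOp ℕ)) (hlt : ∀ op ∈ ops, ∀ i ∈ wiresOf op, i < n + anc P n)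
    (hwf : ∀ op ∈ ops, op.WF) (w : QReg (n + anc P n)) (p : Fin (n + anc P n)) :
    revEval (clamp P n ops hlt hwf) w p = clEval ops (liftW w) p := by
  unfold clamp
  rw [revEval_toRevList, clEval_map_finOf_apply _ ops hlt]

/-- **The input assembly of stage `k`**, compiled (empty for `k ≥ T n`). [cite: NielsenChuang2010, §1.3.4, §4.4] -/
def inGates (n k : ℕ) : List (QGate cliffordT (n + anc P n)) :=
  if h : k < Tn P n then revCompile (clamp P n (progIn P n k) (progIn_lt' h) (progIn_wf h)) else []

/-- **The conjugating swap of block `k`**, compiled (empty for `k ≥ T n`). [cite: NielsenChuang2010, §1.3.4 (swap from three CNOTs)] -/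
def conjGates (n k : ℕ) : List (QGate cliffordT (n + anc P n)) :=
  if h : k < Tn P n then revCompile (clamp P n (progConj P n k) (progConj_lt' h) (progConj_wf n k)) else []

/-- **The stage**: `S.circ (il n k)` on the front wires, verbatim (empty for `k ≥ T n`).
[cite: AroraBarak2009, §6.2 (a circuit for each input length, hard-wired)] -/
def copyGates (n k : ℕ) : List (QGate cliffordT (n + anc P n)) :=
  if h : k < Tn P n then (mapWires (Fin.castLEEmb (rl_fits h)) (P.S.circ (il P n k))).gates else []

/-- Stage `k`: assemble the input, swap, run the stage, swap back. [cite: BernsteinVazirani1997, §8.2 (subroutine calls)] -/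
def stageGates (n k : ℕ) : List (QGate cliffordT (n + anc P n)) :=
  inGates P n k ++ (conjGates P n k ++ (copyGates P n k ++ conjGates P n k))

/-- The gates of the first `k` stages. [folklore] -/
def stagesGates (n k : ℕ) : List (QGate cliffordT (n + anc P n)) :=
  (List.range k).flatMap (stageGates P n)

/-- **The final swap** bringing the last block to the front (empty when there is no stage). [folklore] -/
def finalGates (n : ℕ) : List (QGate cliffordT (n + anc P n)) := conjGates P n (Tn P n - 1)

/-- **The circuit of the chain family on inputs of length `n`.** [cite: BernsteinVazirani1997, §8 (classical control of quantum subroutines)] -/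
def circ (n : ℕ) : QCircuit cliffordT (n + anc P n) := ⟨stagesGates P n (Tn P n) ++ finalGates P n⟩

/-- **The chain family.** [cite: BernsteinVazirani1997, §8] -/
def family : QCircuitFamily cliffordT := ⟨anc P, circ P⟩

/-- The circuit of the family (definitional). [folklore] -/
@[simp] theorem family_circ (n : ℕ) : (family P).circ n = circ P n := rfl

/-- The ancillas of the family (definitional). [folklore] -/
@[simp] theorem family_ancillas (n : ℕ) : (family P).ancillas n = anc P n := rfl

variable {P}

/-- Compiled swaps are oracle-free. [folklore] -/
theorem conjGates_isOracleFree (n k : ℕ) : ∀ g ∈ conjGates P n k, g.IsOracleFree := by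
  intro g hg
  unfold conjGates at hg
  split_ifs at hg with h
  · exact revCompile_isOracleFree _ g hg
  · exact absurd hg List.not_mem_nil

/-- **The family is oracle-free** (if the stage family is). [folklore] -/
theorem family_isOracleFree (hS : P.S.IsOracleFree) : (family P).IsOracleFree := by
  intro n g hg
  have hg' : g ∈ stagesGates P n (Tn P n) ++ finalGates P n := hg
  rcases List.mem_append.1 hg' with h | h
  · obtain ⟨k, -, h⟩ := List.mem_flatMap.1 h
    rcases List.mem_append.1 h with h | h
    · unfold inGates at h
      split_ifs at h with hk
      · exact revCompile_isOracleFree _ g h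
      · exact absurd h List.not_mem_nil
    rcases List.mem_append.1 h with h | h
    · exact conjGates_isOracleFree n k g h
    rcases List.mem_append.1 h with h | h
    · unfold copyGates at h
      split_ifs at h with hk
      · exact isOracleFree_mapWires _ (hS (il P n k)) g h
      · exact absurd h List.not_mem_nil
    · exact conjGates_isOracleFree n k g h
  · exact conjGates_isOracleFree n _ g h

end Compile

/-! ### The compiled programs on basis states -/

section ProgMatrix

variable {P} {n k : ℕ}

/-- **The basis permutation of the input assembly of stage `k`.** [folklore] -/
def piIn (_hk : k < Tn P n) (z : QReg (n + anc P n)) : QReg (n + anc P n) :=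
  fun p => clEval (progIn P n k) (liftW z) p

/-- **The compiled input assembly permutes basis states along `piIn`.** [cite: AroraBarak2009, §10.3.7 Lemma 10.10] -/
theorem toMatrix_inGates_mulVec_basisState (hk : k < Tn P n) (A : Language Bool) (z : QReg (n + anc P n)) :
    (⟨inGates P n k⟩ : QCircuit cliffordT (n + anc P n)).toMatrix A *ᵥ basisState z = basisState (piIn hk z) := by
  unfold inGates
  rw [dif_pos hk, revCompile_mulVec_basisState]
  congr 1
  funext p
  exact revEval_clamp P n _ _ _ z p

/-- `piIn` off block `k` is the identity. [folklore] -/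
theorem piIn_apply_of_ne (hk : k < Tn P n) (z : QReg (n + anc P n)) {p : Fin (n + anc P n)}
    (hp : ∀ q, q < il P n k → (p : ℕ) ≠ blk P n k q) : piIn hk z p = z p := by
  unfold piIn
  rw [clEval_progIn_of_ne _ hp, liftW_val]

/-- Block wires of block `k < T n` are wires of the register. [folklore] -/
theorem blk_fits (hk : k < Tn P n) {q : ℕ} (hq : q < Bw P n) : blk P n k q < n + anc P n := by
  rw [n_add_anc]; exact blk_lt_W hk hq

/-- `piIn` on block `k` XORs the stage input bit. [folklore] -/
theorem piIn_apply_blk (hk : k < Tn P n) (z : QReg (n + anc P n)) {q : ℕ} (hq : q < Bw P n) :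
    piIn hk z ⟨blk P n k q, blk_fits hk hq⟩ = (z ⟨blk P n k q, blk_fits hk hq⟩ ^^ inBits P n k (liftW z) q) := by
  unfold piIn
  rw [show ((⟨blk P n k q, blk_fits hk hq⟩ : Fin (n + anc P n)) : ℕ) = blk P n k q from rfl,
    clEval_progIn_blk hk, ← liftW_val z ⟨blk P n k q, blk_fits hk hq⟩]

/-- Lifting commutes with the assembly permutation. [folklore] -/
theorem liftW_piIn (hk : k < Tn P n) (z : QReg (n + anc P n)) :
    liftW (piIn hk z) = clEval (progIn P n k) (liftW z) := by
  funext p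
  by_cases hp : p < n + anc P n
  · have h := liftW_val (piIn hk z) ⟨p, hp⟩
    exact h
  · have h1 : liftW (piIn hk z) p = false := by unfold liftW; rw [dif_neg hp]
    have h2 : liftW z p = false := by unfold liftW; rw [dif_neg hp]
    rw [h1, clEval_apply_of_forall_target_ne, h2]
    intro op hop e
    obtain ⟨q, hq, rfl⟩ := mem_progIn.1 hop
    rw [target_mkOp] at e
    have := blk_fits hk ((lt_il_of_mem_posAll hq).trans (il_lt_Bw hk))
    omega

/-- **`piIn` is an involution.** [cite: NielsenChuang2010, §3.2.5] -/
theorem piIn_piIn (hk : k < Tn P n) (z : QReg (n + anc P n)) : piIn hk (piIn hk z) = z := by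
  funext p
  unfold piIn
  rw [show liftW (fun p : Fin (n + anc P n) => clEval (progIn P n k) (liftW z) ↑p) =
      clEval (progIn P n k) (liftW z) from liftW_piIn hk z, clEval_progIn_progIn hk, liftW_val]

end ProgMatrix

/-! ### The conjugating swap -/

section Conj

variable {P} {n k : ℕ} (hk : k < Tn P n)

/-- **The wire involution of the conjugating swap**: front wire `i < Bw n` ↔ wire `i` of block `k`,
all other wires fixed. [cite: NielsenChuang2010, §1.3.4 (swap from three CNOTs)] -/
def conjInvol (hk : k < Tn P n) (p : Fin (n + anc P n)) : Fin (n + anc P n) :=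
  if h1 : (p : ℕ) < Bw P n then ⟨blk P n k p, blk_fits hk h1⟩
  else if h2 : blk P n k 0 ≤ p ∧ (p : ℕ) < blk P n k 0 + Bw P n then
    ⟨p - blk P n k 0, by have := p.isLt; omega⟩
  else p

/-- `conjInvol` on a front wire. [folklore] -/
theorem conjInvol_of_lt {p : Fin (n + anc P n)} (hp : (p : ℕ) < Bw P n) : (conjInvol hk p : ℕ) = blk P n k p := by
  unfold conjInvol; rw [dif_pos hp]

/-- `conjInvol` on a block wire. [folklore] -/
theorem conjInvol_blk {i : ℕ} (hi : i < Bw P n) : (conjInvol hk ⟨blk P n k i, blk_fits hk hi⟩ : ℕ) = i := by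
  have h1 : ¬ blk P n k i < Bw P n := Nat.not_lt.2 (base_le_blk n k i)
  have h2 : blk P n k 0 ≤ blk P n k i ∧ blk P n k i < blk P n k 0 + Bw P n := by rw [blk_eq_add n k i]; omega
  unfold conjInvol
  rw [dif_neg h1, dif_pos h2]
  simp [blk_eq_add n k i]

/-- `conjInvol` elsewhere. [folklore] -/
theorem conjInvol_of_not {p : Fin (n + anc P n)} (hp : ¬ (p : ℕ) < Bw P n)
    (hp' : ¬ (blk P n k 0 ≤ p ∧ (p : ℕ) < blk P n k 0 + Bw P n)) : conjInvol hk p = p := by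
  unfold conjInvol; rw [dif_neg hp, dif_neg hp']

/-- **`conjInvol` is an involution.** [folklore] -/
theorem conjInvol_conjInvol (p : Fin (n + anc P n)) : conjInvol hk (conjInvol hk p) = p := by
  by_cases h1 : (p : ℕ) < Bw P n
  · have e : conjInvol hk p = ⟨blk P n k p, blk_fits hk h1⟩ := by unfold conjInvol; rw [dif_pos h1]
    rw [e]
    exact Fin.ext (conjInvol_blk hk h1)
  · by_cases h2 : blk P n k 0 ≤ p ∧ (p : ℕ) < blk P n k 0 + Bw P n
    · have hi : (p : ℕ) - blk P n k 0 < Bw P n := by omega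
      have e : conjInvol hk p = ⟨p - blk P n k 0, by have := p.isLt; omega⟩ := by
        unfold conjInvol; rw [dif_neg h1, dif_pos h2]
      rw [e]
      apply Fin.ext
      rw [conjInvol_of_lt hk (by exact hi)]
      simp only
      rw [blk_eq_add n k]; omega
    · rw [conjInvol_of_not hk h1 h2, conjInvol_of_not hk h1 h2]

/-- **The compiled conjugating swap permutes basis states along `conjInvol`.** [cite: NielsenChuang2010, §1.3.4 (swap from three CNOTs)] -/
theorem toMatrix_conjGates_mulVec_basisState (A : Language Bool) (w : QReg (n + anc P n)) :
    (⟨conjGates P n k⟩ : QCircuit cliffordT (n + anc P n)).toMatrix A *ᵥ basisState w = basisState (w ∘ conjInvol hk) := by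
  unfold conjGates
  rw [dif_pos hk, revCompile_mulVec_basisState]
  congr 1
  funext p
  rw [revEval_clamp]
  unfold progConj
  have h1 : ((conjPairs P n k).map Prod.fst).Nodup := by
    rw [conjPairs, List.map_map]; simpa [Function.comp_def] using List.nodup_range
  have h2 : ((conjPairs P n k).map Prod.snd).Nodup := by
    rw [conjPairs, List.map_map]
    exact List.nodup_range.map_on fun a _ c _ h => by simp only [Function.comp_apply] at h; unfold blk at h; omega
  have h12 : ∀ q ∈ conjPairs P n k, ∀ q' ∈ conjPairs P n k, q.1 ≠ q'.2 := by
    intro q hq q' hq'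
    simp only [conjPairs, List.mem_map, List.mem_range] at hq hq'
    obtain ⟨i, hi, rfl⟩ := hq; obtain ⟨i', -, rfl⟩ := hq'
    exact Nat.ne_of_lt (lt_blk_of_lt_Bw hi k i')
  obtain ⟨hsnd, hfst, hother⟩ := clEval_swapOps (conjPairs P n k) h1 h2 h12 (liftW w)
  simp only [Function.comp_apply]
  by_cases hp : (p : ℕ) < Bw P n
  · have hmem : ((p : ℕ), blk P n k p) ∈ conjPairs P n k := List.mem_map.2 ⟨p, List.mem_range.2 hp, rfl⟩
    rw [hfst _ hmem]
    change liftW w (blk P n k p) = w (conjInvol hk p)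
    rw [← liftW_val w (conjInvol hk p), conjInvol_of_lt hk hp]
  · by_cases hp2 : blk P n k 0 ≤ p ∧ (p : ℕ) < blk P n k 0 + Bw P n
    · have hi : (p : ℕ) - blk P n k 0 < Bw P n := by omega
      have hpe : (p : ℕ) = blk P n k (p - blk P n k 0) := by rw [blk_eq_add n k]; omega
      have hmem : ((p : ℕ) - blk P n k 0, (p : ℕ)) ∈ conjPairs P n k :=
        List.mem_map.2 ⟨_, List.mem_range.2 hi, by rw [← hpe]⟩
      rw [hsnd _ hmem]
      change liftW w ((p : ℕ) - blk P n k 0) = w (conjInvol hk p)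
      rw [← liftW_val w (conjInvol hk p)]
      congr 1
      unfold conjInvol; rw [dif_neg hp, dif_pos hp2]
    · rw [hother _ (fun q hq => ?_), conjInvol_of_not hk hp hp2, liftW_val]
      simp only [conjPairs, List.mem_map, List.mem_range] at hq
      obtain ⟨i, hi, rfl⟩ := hq
      refine ⟨fun h => hp (h ▸ hi), fun h => hp2 ?_⟩
      rw [h, blk_eq_add n k i]; omega

/-- **The register of stage `k` as an embedding of `rl n k` wires into block `k`.** [folklore] -/
def stageEmb (hk : k < Tn P n) : Fin (rl P n k) ↪ Fin (n + anc P n) :=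
  ⟨fun i => ⟨blk P n k i, blk_fits hk (lt_of_lt_of_le i.isLt (rl_le_Bw hk))⟩,
    fun _ _ h => Fin.ext (by have := congrArg Fin.val h; simp only at this; unfold blk at this; omega)⟩

/-- `stageEmb` evaluated. [folklore] -/
@[simp] theorem stageEmb_apply_val (i : Fin (rl P n k)) : (stageEmb hk i : ℕ) = blk P n k i := rfl

/-- **Swap–stage–swap is the stage placed on block `k`.** [cite: NielsenChuang2010, §4.3 (a gate on a subset of the wires is U ⊗ 1 up to the order of the factors)] -/
theorem toMatrix_conjBlock (A : Language Bool) :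
    (⟨conjGates P n k ++ (copyGates P n k ++ conjGates P n k)⟩ : QCircuit cliffordT (n + anc P n)).toMatrix A =
      placeGate (stageEmb hk) ((P.S.circ (il P n k)).toMatrix A) := by
  unfold copyGates
  rw [dif_pos hk, toMatrix_conj_mapWires A (conjInvol hk) (conjInvol_conjInvol hk) (conjGates P n k)
    (toMatrix_conjGates_mulVec_basisState hk A) (Fin.castLEEmb (rl_fits hk)) (P.S.circ (il P n k)),
    toMatrix_mapWires]
  congr 1
  ext i
  simp only [Function.Embedding.trans_apply, Fin.castLEEmb_apply, invEmb_apply, stageEmb_apply_val]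
  exact conjInvol_of_lt hk (lt_of_lt_of_le i.isLt (rl_le_Bw hk))

/-- **The matrix of stage `k`**: the placed stage after the assembly permutation. [folklore] -/
theorem toMatrix_stageGates (A : Language Bool) :
    (⟨stageGates P n k⟩ : QCircuit cliffordT (n + anc P n)).toMatrix A =
      placeGate (stageEmb hk) ((P.S.circ (il P n k)).toMatrix A) * (⟨inGates P n k⟩ : QCircuit cliffordT (n + anc P n)).toMatrix A := by
  rw [stageGates, show (⟨inGates P n k ++ (conjGates P n k ++ (copyGates P n k ++ conjGates P n k))⟩ : QCircuit cliffordT (n + anc P n)) =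
      (⟨inGates P n k⟩ : QCircuit cliffordT _).append ⟨conjGates P n k ++ (copyGates P n k ++ conjGates P n k)⟩ from rfl,
    QCircuit.toMatrix_append, toMatrix_conjBlock hk]

end Conj

/-! ## Part III. The state after the stages -/

section State

variable {P}

/-- **A matrix permuting basis states along an involution acts by pre-composition**:
`M|z⟩ = |π z⟩`, `π ∘ π = id` ⟹ `(Mψ)(y) = ψ(π y)`. [cite: NielsenChuang2010, §3.2.5] -/
theorem mulVec_eq_of_invol {N : ℕ} {M : Matrix (QReg N) (QReg N) ℂ} (π : QReg N → QReg N)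
    (hM : ∀ z, M *ᵥ basisState z = basisState (π z)) (hπ : ∀ z, π (π z) = z) (ψ : QReg N → ℂ) :
    M *ᵥ ψ = fun y => ψ (π y) := by
  let e : QReg N ↪ QReg N := ⟨π, fun a b h => by rw [← hπ a, h, hπ]⟩
  rw [mulVec_eq_of_perm e hM ψ]
  funext y
  congr 1
  rw [Equiv.symm_apply_eq]
  exact (hπ y).symm

variable (P) (x : List Bool)

/-- The register width of the chain family on `x`. [folklore] -/
abbrev Wx : ℕ := x.length + anc P x.length

/-- **The front window holds `x` followed by zeros.** [folklore] -/
def FrontOK (z : QReg (Wx P x)) : Prop :=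
  ∀ p : Fin (Wx P x), (p : ℕ) < Bw P x.length → z p = PostBQPAmp.inp x p

variable {x} in
/-- Wire `q < Bw` of block `k < T |x|`. [folklore] -/
def bw {k : ℕ} (hk : k < Tn P x.length) (q : ℕ) (hq : q < Bw P x.length) : Fin (Wx P x) :=
  ⟨blk P x.length k q, blk_fits hk hq⟩

variable {x}

/-- **Block `k` is empty.** [folklore] -/
def BlockZero {k : ℕ} (hk : k < Tn P x.length) (z : QReg (Wx P x)) : Prop :=
  ∀ q (hq : q < Bw P x.length), z (bw P hk q hq) = false

/-- **Block `k` is empty beyond the stage register.** [folklore] -/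
def TailZero {k : ℕ} (hk : k < Tn P x.length) (z : QReg (Wx P x)) : Prop :=
  ∀ q (hq : q < Bw P x.length), rl P x.length k ≤ q → z (bw P hk q hq) = false

/-- **Block `k` holds the assembled stage input** (and zeros beyond). [folklore] -/
def BlockIn {k : ℕ} (hk : k < Tn P x.length) (z : QReg (Wx P x)) : Prop :=
  ∀ q (hq : q < Bw P x.length), z (bw P hk q hq) = inBits P x.length k (liftW z) q

variable (x) in
/-- **The stage input register of stage `k` read off a label.** [folklore] -/
def inReg (k : ℕ) (z : QReg (Wx P x)) : QReg (il P x.length k) := fun q => inBits P x.length k (liftW z) q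

/-- **The amplitude carried by block `k`**: that of the stage `S.circ (il k)` from the assembled input
(padded with the stage's ancilla zeros) to the content of the block's register wires — provided the
block is empty beyond them. [cite: NielsenChuang2010, §4.3 (U ⊗ 1 on basis states)] -/
def amp (A : Language Bool) {k : ℕ} (hk : k < Tn P x.length) (z : QReg (Wx P x)) : ℂ :=
  open Classical in
  if TailZero P hk z then
    ((P.S.circ (il P x.length k)).toMatrix A) (z ∘ stageEmb hk) (padInput (inReg P x k z) (P.S.ancillas (il P x.length k)))
  else 0

/-- The amplitude of block `k`, `1` beyond the last block. [folklore] -/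
def ampD (A : Language Bool) (k : ℕ) (z : QReg (Wx P x)) : ℂ := if hk : k < Tn P x.length then amp P A hk z else 1

variable (x) in
/-- **The state after `k` stages** ("Markov product" of the block amplitudes): supported on labels
whose front window holds `x 0…0` and whose blocks `j ≥ k` are empty, with amplitude the product of
the amplitudes carried by the blocks `j < k`. [cite: NielsenChuang2010, §4.4 (deferred measurement: the joint state of the copied registers)] -/
def stateAfter (A : Language Bool) (k : ℕ) (z : QReg (Wx P x)) : ℂ :=
  open Classical in
  if FrontOK P x z ∧ ∀ j (hj : j < Tn P x.length), k ≤ j → BlockZero P hj z then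
    ∏ j ∈ Finset.range k, ampD P A j z
  else 0

/-! ### Reading lemmas -/

/-- `inBits` only reads the first `n` front wires and the window of block `k-1`. [folklore] -/
theorem inBits_congr (n k : ℕ) {w w' : ℕ → Bool} (h1 : ∀ i < n, w i = w' i)
    (h2 : ∀ j < yl P n k, w (blk P n (k - 1) j) = w' (blk P n (k - 1) j)) : inBits P n k w = inBits P n k w' := by
  funext q
  unfold inBits
  rw [show (List.ofFn fun i : Fin n => w i) = List.ofFn fun i : Fin n => w' i from
      List.ofFn_inj.2 (funext fun i => h1 i i.isLt),
    show (List.ofFn fun j : Fin (yl P n k) => w (blk P n (k - 1) j)) =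
      List.ofFn fun j : Fin (yl P n k) => w' (blk P n (k - 1) j) from
      List.ofFn_inj.2 (funext fun j => h2 j j.isLt)]

/-- `inBits` vanishes from the input length on. [folklore] -/
theorem inBits_of_le (n k : ℕ) (w : ℕ → Bool) {q : ℕ} (hq : il P n k ≤ q) : inBits P n k w q = false := by
  rw [inBits_eq, if_neg fun h => absurd (lt_il_of_mem_posAll h) (Nat.not_lt.2 hq)]

/-- Two labels that agree on the first `n` front wires and on the window of block `k-1` assemble the
same stage input. [folklore] -/
theorem inReg_congr (k : ℕ) {z z' : QReg (Wx P x)}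
    (h1 : ∀ p : Fin (Wx P x), (p : ℕ) < x.length → z p = z' p)
    (h2 : ∀ p : Fin (Wx P x), (∃ j < yl P x.length k, (p : ℕ) = blk P x.length (k - 1) j) → z p = z' p) :
    inReg P x k z = inReg P x k z' := by
  funext q
  unfold inReg
  rw [inBits_congr (P := P) x.length k (w := liftW z) (w' := liftW z')]
  · intro i hi
    have hi' : i < Wx P x := lt_of_lt_of_le hi (by unfold Wx; omega)
    unfold liftW
    rw [dif_pos hi', dif_pos hi']
    exact h1 _ hi
  · intro j hj
    by_cases hk : k = 0
    · subst hk; simp at hj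
    · by_cases hlt : blk P x.length (k - 1) j < Wx P x
      · unfold liftW
        rw [dif_pos hlt, dif_pos hlt]
        exact h2 _ ⟨j, hj, rfl⟩
      · unfold liftW; rw [dif_neg hlt, dif_neg hlt]

/-- `amp` only reads block `k`, the front bits of `x`, and the window of block `k-1`. [folklore] -/
theorem amp_congr (A : Language Bool) {k : ℕ} (hk : k < Tn P x.length) {z z' : QReg (Wx P x)}
    (hb : ∀ q (hq : q < Bw P x.length), z (bw P hk q hq) = z' (bw P hk q hq))
    (h1 : ∀ p : Fin (Wx P x), (p : ℕ) < x.length → z p = z' p)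
    (h2 : ∀ p : Fin (Wx P x), (∃ j < yl P x.length k, (p : ℕ) = blk P x.length (k - 1) j) → z p = z' p) :
    amp P A hk z = amp P A hk z' := by
  unfold amp
  have ht : TailZero P hk z ↔ TailZero P hk z' := by
    unfold TailZero
    exact ⟨fun h q hq hle => (hb q hq) ▸ h q hq hle, fun h q hq hle => (hb q hq).symm ▸ h q hq hle⟩
  have he : z ∘ stageEmb hk = z' ∘ stageEmb hk := funext fun i =>
    hb i (lt_of_lt_of_le i.isLt (rl_le_Bw hk))
  rw [inReg_congr P k h1 h2, he]
  by_cases h : TailZero P hk z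
  · rw [if_pos h, if_pos (ht.1 h)]
  · rw [if_neg h, if_neg fun h' => h (ht.2 h')]

/-! ### Wires: front, or a block -/

/-- **Every wire beyond the front window lies in a block.** [folklore] -/
theorem exists_bw_of_le {p : Fin (Wx P x)} (hp : Bw P x.length ≤ (p : ℕ)) :
    ∃ j, ∃ hj : j < Tn P x.length, ∃ q, ∃ hq : q < Bw P x.length, p = bw P hj q hq := by
  have hB : 0 < Bw P x.length := Bw_pos _
  have hw : (p : ℕ) < W P x.length := by rw [← n_add_anc]; exact p.isLt
  set d := (p : ℕ) - Bw P x.length with hd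
  have hdlt : d < Tn P x.length * Bw P x.length := by unfold W base at hw; omega
  have hjlt : d / Bw P x.length < Tn P x.length := (Nat.div_lt_iff_lt_mul hB).2 hdlt
  have hqlt : d % Bw P x.length < Bw P x.length := Nat.mod_lt _ hB
  refine ⟨d / Bw P x.length, hjlt, d % Bw P x.length, hqlt, Fin.ext ?_⟩
  change (p : ℕ) = blk P x.length (d / Bw P x.length) (d % Bw P x.length)
  unfold blk base
  have := Nat.div_add_mod d (Bw P x.length)
  rw [Nat.mul_comm] at this
  omega

/-- A front wire is not a block wire. [folklore] -/
theorem ne_blk_of_lt_Bw {p : ℕ} (hp : p < Bw P x.length) (k q : ℕ) : p ≠ blk P x.length k q :=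
  Nat.ne_of_lt (lt_blk_of_lt_Bw hp k q)

/-- Wires of distinct blocks differ. [folklore] -/
theorem bw_ne_blk {j k : ℕ} (hj : j < Tn P x.length) (hjk : j ≠ k) {q : ℕ} (hq : q < Bw P x.length)
    {q' : ℕ} (hq' : q' < Bw P x.length) : (bw P hj q hq : ℕ) ≠ blk P x.length k q' := fun e =>
  hjk (blk_inj hq hq' e).1

/-! ### The assembly permutation on the state -/

section PiIn

variable {k : ℕ} (hk : k < Tn P x.length) (A : Language Bool)

/-- `piIn` keeps the front window. [folklore] -/
theorem piIn_front (z : QReg (Wx P x)) {p : Fin (Wx P x)} (hp : (p : ℕ) < Bw P x.length) : piIn hk z p = z p :=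
  piIn_apply_of_ne hk z fun q _ => ne_blk_of_lt_Bw P hp k q

/-- `piIn` keeps the other blocks. [folklore] -/
theorem piIn_bw_of_ne (z : QReg (Wx P x)) {j : ℕ} (hj : j < Tn P x.length) (hjk : j ≠ k) (q : ℕ) (hq : q < Bw P x.length) :
    piIn hk z (bw P hj q hq) = z (bw P hj q hq) :=
  piIn_apply_of_ne hk z fun _ hq' => bw_ne_blk P hj hjk hq (hq'.trans (il_lt_Bw hk))

/-- `piIn` on block `k`. [folklore] -/
theorem piIn_bw (z : QReg (Wx P x)) (q : ℕ) (hq : q < Bw P x.length) :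
    piIn hk z (bw P hk q hq) = (z (bw P hk q hq) ^^ inBits P x.length k (liftW z) q) :=
  piIn_apply_blk hk z hq

/-- `liftW ∘ piIn` off block `k`. [folklore] -/
theorem liftW_piIn_of_ne (z : QReg (Wx P x)) {p : ℕ} (hp : ∀ q, q < il P x.length k → p ≠ blk P x.length k q) :
    liftW (piIn hk z) p = liftW z p := by
  rw [liftW_piIn hk, clEval_progIn_of_ne _ hp]

/-- The amplitudes of the earlier blocks do not see the assembly of block `k`. [folklore] -/
theorem ampD_piIn {j : ℕ} (hjk : j < k) (z : QReg (Wx P x)) : ampD P A j (piIn hk z) = ampD P A j z := by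
  have hj : j < Tn P x.length := hjk.trans hk
  unfold ampD
  rw [dif_pos hj, dif_pos hj]
  refine amp_congr P A hj (fun q hq => piIn_bw_of_ne P hk z hj (Nat.ne_of_lt hjk) q hq)
    (fun p hp => piIn_front P hk z (hp.trans (lt_Bw _))) (fun p ⟨i, hi, hpi⟩ => ?_)
  refine piIn_apply_of_ne hk z fun q hq e => ?_
  rw [hpi] at e
  have hiB : i < Bw P x.length := hi.trans_le ((yl_le _ _).trans (mn_lt_Bw _).le)
  have hjm1 : j - 1 < Tn P x.length := by omega
  exact bw_ne_blk P hjm1 (by omega) hiB (hq.trans (il_lt_Bw hk)) e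

/-- **The state after `k` stages, pulled back along the assembly of block `k`**: block `k` must now
hold the assembled input. [cite: NielsenChuang2010, §4.4] -/
theorem stateAfter_piIn (z : QReg (Wx P x)) :
    stateAfter P x A k (piIn hk z) =
      open Classical in
      if FrontOK P x z ∧ BlockIn P hk z ∧ ∀ j (hj : j < Tn P x.length), k < j → BlockZero P hj z then
        ∏ j ∈ Finset.range k, ampD P A j z
      else 0 := by
  classical
  unfold stateAfter
  have hfront : FrontOK P x (piIn hk z) ↔ FrontOK P x z := by
    unfold FrontOK
    exact ⟨fun h p hp => (piIn_front P hk z hp) ▸ h p hp, fun h p hp => (piIn_front P hk z hp).symm ▸ h p hp⟩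
  have hblocks : (∀ j (hj : j < Tn P x.length), k ≤ j → BlockZero P hj (piIn hk z)) ↔
      (BlockIn P hk z ∧ ∀ j (hj : j < Tn P x.length), k < j → BlockZero P hj z) := by
    constructor
    · intro h
      refine ⟨fun q hq => ?_, fun j hj hkj q hq => ?_⟩
      · have h1 := h k hk le_rfl q hq
        rw [piIn_bw P hk z q hq] at h1
        revert h1
        cases z (bw P hk q hq) <;> cases inBits P x.length k (liftW z) q <;> simp
      · have h1 := h j hj hkj.le q hq
        rwa [piIn_bw_of_ne P hk z hj (Nat.ne_of_gt hkj) q hq] at h1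
    · rintro ⟨hin, h⟩ j hj hkj q hq
      rcases Nat.eq_or_lt_of_le hkj with rfl | hlt
      · rw [piIn_bw P hk z q hq, hin q hq]
        cases inBits P x.length k (liftW z) q <;> rfl
      · rw [piIn_bw_of_ne P hk z hj (Nat.ne_of_gt hlt) q hq]
        exact h j hj hlt q hq
  have hprod : ∏ j ∈ Finset.range k, ampD P A j (piIn hk z) = ∏ j ∈ Finset.range k, ampD P A j z :=
    Finset.prod_congr rfl fun j hj => ampD_piIn P hk A (Finset.mem_range.1 hj) z
  rw [hprod]
  by_cases h : FrontOK P x z ∧ BlockIn P hk z ∧ ∀ j (hj : j < Tn P x.length), k < j → BlockZero P hj z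
  · rw [if_pos h, if_pos ⟨hfront.2 h.1, hblocks.2 h.2⟩]
  · rw [if_neg h, if_neg fun h' => h ⟨hfront.1 h'.1, hblocks.1 h'.2⟩]

end PiIn

/-! ### The stage on the state -/

section Stage

variable {k : ℕ} (hk : k < Tn P x.length) (A : Language Bool)

variable (x) in
/-- **The padded input register of stage `k`**: the assembled input and the stage's ancilla zeros. [folklore] -/
def u0 (k : ℕ) (z : QReg (Wx P x)) : QReg (rl P x.length k) :=
  padInput (inReg P x k z) (P.S.ancillas (il P x.length k))

/-- The padded input register, entrywise: the stage input bit table. [folklore] -/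
theorem u0_apply (z : QReg (Wx P x)) (i : Fin (rl P x.length k)) : u0 P x k z i = inBits P x.length k (liftW z) i := by
  unfold u0 padInput
  by_cases hi : (i : ℕ) < il P x.length k
  · rw [show i = Fin.castAdd (P.S.ancillas (il P x.length k)) ⟨i, hi⟩ from Fin.ext rfl, Fin.append_left]
    rfl
  · have hi2 : (i : ℕ) < il P x.length k + P.S.ancillas (il P x.length k) := i.isLt
    rw [inBits_of_le P _ _ _ (Nat.not_lt.1 hi),
      show i = Fin.natAdd (il P x.length k) ⟨i - il P x.length k, by omega⟩ from
        Fin.ext (by simp; omega), Fin.append_right]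

/-- Overwriting the register wires of block `k`: on those wires. [folklore] -/
theorem extend_bw_of_lt (u : QReg (rl P x.length k)) (z : QReg (Wx P x)) {q : ℕ} (hq : q < rl P x.length k) :
    Function.extend (stageEmb hk) u z (bw P hk q (hq.trans_le (rl_le_Bw hk))) = u ⟨q, hq⟩ := by
  have e : bw P hk q (hq.trans_le (rl_le_Bw hk)) = stageEmb hk ⟨q, hq⟩ := Fin.ext rfl
  rw [e, (stageEmb hk).injective.extend_apply]

/-- Overwriting the register wires of block `k`: elsewhere. [folklore] -/
theorem extend_apply_of_ne (u : QReg (rl P x.length k)) (z : QReg (Wx P x)) {p : Fin (Wx P x)}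
    (hp : ∀ q, q < rl P x.length k → (p : ℕ) ≠ blk P x.length k q) : Function.extend (stageEmb hk) u z p = z p :=
  extend_apply_of_not_mem _ _ _ (by rintro ⟨i, rfl⟩; exact hp i i.isLt rfl)

/-- Overwriting block `k` keeps the amplitudes of the earlier blocks. [folklore] -/
theorem ampD_extend {j : ℕ} (hjk : j < k) (u : QReg (rl P x.length k)) (z : QReg (Wx P x)) :
    ampD P A j (Function.extend (stageEmb hk) u z) = ampD P A j z := by
  have hj : j < Tn P x.length := hjk.trans hk
  have hrl := rl_le_Bw (P := P) hk
  unfold ampD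
  rw [dif_pos hj, dif_pos hj]
  refine amp_congr P A hj (fun q hq => extend_apply_of_ne P hk u z fun q' hq' => bw_ne_blk P hj (Nat.ne_of_lt hjk) hq (hq'.trans_le hrl))
    (fun p hp => extend_apply_of_ne P hk u z fun q' _ => ne_blk_of_lt_Bw P (hp.trans (lt_Bw _)) k q')
    (fun p ⟨i, hi, hpi⟩ => extend_apply_of_ne P hk u z fun q' hq' e => ?_)
  rw [hpi] at e
  have hiB : i < Bw P x.length := hi.trans_le ((yl_le _ _).trans (mn_lt_Bw _).le)
  have hjm1 : j - 1 < Tn P x.length := by omega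
  exact bw_ne_blk P hjm1 (by omega) hiB (hq'.trans_le hrl) e

/-- Overwriting block `k` keeps the assembled input of stage `k` (it is read off the front window and
block `k-1`). [folklore] -/
theorem inBits_extend (u : QReg (rl P x.length k)) (z : QReg (Wx P x)) :
    inBits P x.length k (liftW (Function.extend (stageEmb hk) u z)) = inBits P x.length k (liftW z) := by
  have hrl := rl_le_Bw (P := P) hk
  refine inBits_congr P x.length k (fun i hi => ?_) (fun j hj => ?_)
  · have hi' : i < Wx P x := lt_of_lt_of_le hi (by unfold Wx; omega)
    unfold liftW
    rw [dif_pos hi', dif_pos hi']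
    exact extend_apply_of_ne P hk u z fun q' _ => ne_blk_of_lt_Bw P (hi.trans (lt_Bw _)) k q'
  · by_cases hk0 : k = 0
    · subst hk0; simp at hj
    · by_cases hlt : blk P x.length (k - 1) j < Wx P x
      · unfold liftW
        rw [dif_pos hlt, dif_pos hlt]
        have hkm1 : k - 1 < Tn P x.length := by omega
        have hjB : j < Bw P x.length := hj.trans_le ((yl_le _ _).trans (mn_lt_Bw _).le)
        exact extend_apply_of_ne P hk u z fun q' hq' =>
          bw_ne_blk P hkm1 (by omega) hjB (hq'.trans_le hrl)
      · unfold liftW; rw [dif_neg hlt, dif_neg hlt]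

/-- **Block `k` of the overwritten label holds the assembled input iff the register wires were
overwritten with the padded input and the rest of the block is empty.** [folklore] -/
theorem blockIn_extend_iff (u : QReg (rl P x.length k)) (z : QReg (Wx P x)) :
    BlockIn P hk (Function.extend (stageEmb hk) u z) ↔ u = u0 P x k z ∧ TailZero P hk z := by
  have hrl := rl_le_Bw (P := P) hk
  unfold BlockIn TailZero
  simp only [inBits_extend P hk u z]
  constructor
  · intro h
    refine ⟨funext fun i => ?_, fun q hq hle => ?_⟩
    · have h1 := h i (i.isLt.trans_le hrl)
      rw [extend_bw_of_lt P hk u z i.isLt] at h1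
      rw [u0_apply]
      exact h1
    · have h1 := h q hq
      rw [extend_apply_of_ne P hk u z (fun q' hq' e => ?_)] at h1
      · rw [h1]
        exact inBits_of_le P _ _ _ ((il_le_rl _ _).trans hle)
      · change blk P x.length k q = blk P x.length k q' at e
        unfold blk at e; omega
  · rintro ⟨rfl, ht⟩ q hq
    by_cases hlt : q < rl P x.length k
    · rw [extend_bw_of_lt P hk _ z hlt, u0_apply]
    · rw [extend_apply_of_ne P hk _ z (fun q' hq' e => ?_), ht q hq (Nat.not_lt.1 hlt),
        inBits_of_le P _ _ _ ((il_le_rl _ _).trans (Nat.not_lt.1 hlt))]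
      change blk P x.length k q = blk P x.length k q' at e
      unfold blk at e; omega

/-- **One stage on the state**: the placed stage applied to the pulled-back state gives the state
after `k + 1` stages (the sum over the overwritten register collapses to the assembled input).
[cite: NielsenChuang2010, §4.3 (U ⊗ 1), §4.4 (deferred measurement)] -/
theorem placeGate_mulVec_stateAfter_piIn :
    placeGate (stageEmb hk) ((P.S.circ (il P x.length k)).toMatrix A) *ᵥ (fun z => stateAfter P x A k (piIn hk z)) =
      stateAfter P x A (k + 1) := by
  classical
  have hrl := rl_le_Bw (P := P) hk
  funext z
  rw [placeGate_mulVec_apply]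
  simp only [stateAfter_piIn P hk A]
  -- the conditions on the overwritten label
  have hfront : ∀ u, FrontOK P x (Function.extend (stageEmb hk) u z) ↔ FrontOK P x z := fun u => by
    unfold FrontOK
    constructor
    · intro h p hp; rw [← h p hp, extend_apply_of_ne P hk u z fun q' _ => ne_blk_of_lt_Bw P hp k q']
    · intro h p hp; rw [extend_apply_of_ne P hk u z fun q' _ => ne_blk_of_lt_Bw P hp k q']; exact h p hp
  have hlater : ∀ u, (∀ j (hj : j < Tn P x.length), k < j → BlockZero P hj (Function.extend (stageEmb hk) u z)) ↔
      ∀ j (hj : j < Tn P x.length), k < j → BlockZero P hj z := fun u => by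
    refine forall_congr' fun j => forall_congr' fun hj => forall_congr' fun hkj => ?_
    unfold BlockZero
    refine forall_congr' fun q => forall_congr' fun hq => ?_
    rw [extend_apply_of_ne P hk u z fun q' hq' => bw_ne_blk P hj (Nat.ne_of_gt hkj) hq (hq'.trans_le hrl)]
  have hprod : ∀ u, ∏ j ∈ Finset.range k, ampD P A j (Function.extend (stageEmb hk) u z) =
      ∏ j ∈ Finset.range k, ampD P A j z := fun u =>
    Finset.prod_congr rfl fun j hj => ampD_extend P hk A (Finset.mem_range.1 hj) u z
  simp only [hfront, hlater, hprod, blockIn_extend_iff P hk]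
  -- the sum collapses to `u = u0`
  rw [Finset.sum_eq_single (u0 P x k z)]
  · -- the main term
    have hmain : (if FrontOK P x z ∧ (u0 P x k z = u0 P x k z ∧ TailZero P hk z) ∧
          ∀ j (hj : j < Tn P x.length), k < j → BlockZero P hj z
        then ∏ j ∈ Finset.range k, ampD P A j z else 0) =
        if FrontOK P x z ∧ TailZero P hk z ∧ ∀ j (hj : j < Tn P x.length), k < j → BlockZero P hj z
        then ∏ j ∈ Finset.range k, ampD P A j z else 0 := by
      by_cases h : FrontOK P x z ∧ TailZero P hk z ∧ ∀ j (hj : j < Tn P x.length), k < j → BlockZero P hj z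
      · rw [if_pos h, if_pos ⟨h.1, ⟨rfl, h.2.1⟩, h.2.2⟩]
      · rw [if_neg h, if_neg fun h' => h ⟨h'.1, h'.2.1.2, h'.2.2⟩]
    rw [hmain]
    unfold stateAfter
    rw [Finset.prod_range_succ]
    have hampk : ampD P A k z = amp P A hk z := by unfold ampD; rw [dif_pos hk]
    rw [hampk]
    unfold amp u0
    by_cases hF : FrontOK P x z ∧ ∀ j (hj : j < Tn P x.length), k < j → BlockZero P hj z
    · have hF' : FrontOK P x z ∧ ∀ j (hj : j < Tn P x.length), k + 1 ≤ j → BlockZero P hj z := hF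
      by_cases ht : TailZero P hk z
      · rw [if_pos ⟨hF.1, ht, hF.2⟩, if_pos hF', if_pos ht, mul_comm]
      · rw [if_neg (fun h => ht h.2.1), if_pos hF', if_neg ht, mul_zero, mul_zero]
    · have hF' : ¬ (FrontOK P x z ∧ ∀ j (hj : j < Tn P x.length), k + 1 ≤ j → BlockZero P hj z) := hF
      rw [if_neg (fun h => hF ⟨h.1, h.2.2⟩), if_neg hF', mul_zero]
  · intro u _ hu
    rw [if_neg (fun h => hu h.2.1.1), mul_zero]
  · intro h; exact absurd (Finset.mem_univ _) h

end Stage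

/-! ### The induction over the stages -/

section Induction

variable (A : Language Bool)

/-- **The initial state is the state after `0` stages.** [folklore] -/
theorem basisState_padInput_eq_stateAfter_zero :
    basisState (padInput x.get (anc P x.length)) = stateAfter P x A 0 := by
  classical
  funext z
  rw [basisState_apply]
  unfold stateAfter
  simp only [Finset.range_zero, Finset.prod_empty, zero_le, forall_true_left]
  have hinp : ∀ p : Fin (Wx P x), padInput x.get (anc P x.length) p = PostBQPAmp.inp x p := fun p => by
    rw [← liftW_val (padInput x.get (anc P x.length)) p, PostBQPAmp.liftW_padInput_get]
  by_cases h : z = padInput x.get (anc P x.length)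
  · subst h
    rw [if_pos rfl, if_pos]
    refine ⟨fun p _ => hinp p, fun j hj q hq => ?_⟩
    rw [hinp]
    exact PostBQPAmp.inp_of_le x ((lt_Bw (P := P) x.length).le.trans (base_le_blk _ j q))
  · rw [if_neg h, if_neg]
    rintro ⟨hf, hb⟩
    apply h
    funext p
    rw [hinp]
    by_cases hp : (p : ℕ) < Bw P x.length
    · exact hf p hp
    · obtain ⟨j, hj, q, hq, rfl⟩ := exists_bw_of_le P (Nat.not_lt.1 hp)
      rw [hb j hj q hq]
      exact (PostBQPAmp.inp_of_le x ((lt_Bw (P := P) x.length).le.trans (base_le_blk _ j q))).symm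

/-- One more stage of gates. [folklore] -/
theorem stagesGates_succ (n k : ℕ) : stagesGates P n (k + 1) = stagesGates P n k ++ stageGates P n k := by
  rw [stagesGates, stagesGates, List.range_succ, List.flatMap_append, List.flatMap_singleton]

/-- **The state after the first `k ≤ T |x|` stages.** [cite: NielsenChuang2010, §4.4 (deferred measurement)] -/
theorem toMatrix_stagesGates_mulVec (k : ℕ) (hk : k ≤ Tn P x.length) :
    (⟨stagesGates P x.length k⟩ : QCircuit cliffordT (Wx P x)).toMatrix A *ᵥ basisState (padInput x.get (anc P x.length)) =
      stateAfter P x A k := by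
  induction k with
  | zero =>
    have h1 : (⟨stagesGates P x.length 0⟩ : QCircuit cliffordT (Wx P x)).toMatrix A = 1 := by
      simp [stagesGates, QCircuit.toMatrix]
    rw [h1, Matrix.one_mulVec]
    exact basisState_padInput_eq_stateAfter_zero P A
  | succ k ih =>
    have hk' : k < Tn P x.length := Nat.lt_of_succ_le hk
    rw [stagesGates_succ, show (⟨stagesGates P x.length k ++ stageGates P x.length k⟩ : QCircuit cliffordT (Wx P x)) =
        (⟨stagesGates P x.length k⟩ : QCircuit cliffordT _).append ⟨stageGates P x.length k⟩ from rfl,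
      QCircuit.toMatrix_append, ← Matrix.mulVec_mulVec, ih hk'.le, toMatrix_stageGates hk', ← Matrix.mulVec_mulVec,
      mulVec_eq_of_invol (piIn hk') (toMatrix_inGates_mulVec_basisState hk' A) (piIn_piIn hk')]
    exact placeGate_mulVec_stateAfter_piIn P hk' A

/-- **The state after all the stages** (before the final swap). [cite: NielsenChuang2010, §4.4] -/
theorem runOn_stages :
    (⟨stagesGates P x.length (Tn P x.length)⟩ : QCircuit cliffordT (Wx P x)).runOn A (basisState (padInput x.get (anc P x.length))) =
      stateAfter P x A (Tn P x.length) :=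
  toMatrix_stagesGates_mulVec P A _ le_rfl

end Induction

/-! ### The final swap and the output kernel -/

section Final

variable (A : Language Bool)

/-- The index of the last stage is a stage. [folklore] -/
theorem last_lt {n : ℕ} (hT : 0 < Tn P n) : Tn P n - 1 < Tn P n := Nat.sub_lt hT Nat.one_pos

/-- **The final swap permutes basis states along the conjugating involution of the last block.**
[cite: NielsenChuang2010, §1.3.4 (swap from three CNOTs)] -/
theorem toMatrix_finalGates_mulVec_basisState (hT : 0 < Tn P x.length) (z : QReg (Wx P x)) :
    (⟨finalGates P x.length⟩ : QCircuit cliffordT (Wx P x)).toMatrix A *ᵥ basisState z =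
      basisState (z ∘ conjInvol (last_lt P hT)) :=
  toMatrix_conjGates_mulVec_basisState (last_lt P hT) A z

/-- **The final state of the chain family**: the state after all stages, relabelled by the final
swap. [cite: NielsenChuang2010, §4.4] -/
theorem runOn_circ :
    (circ P x.length).runOn A (basisState (padInput x.get (anc P x.length))) =
      (⟨finalGates P x.length⟩ : QCircuit cliffordT (Wx P x)).toMatrix A *ᵥ stateAfter P x A (Tn P x.length) := by
  rw [QCircuit.runOn, circ, show (⟨stagesGates P x.length (Tn P x.length) ++ finalGates P x.length⟩ : QCircuit cliffordT (Wx P x)) =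
      (⟨stagesGates P x.length (Tn P x.length)⟩ : QCircuit cliffordT _).append ⟨finalGates P x.length⟩ from rfl,
    QCircuit.toMatrix_append, ← Matrix.mulVec_mulVec]
  congr 1
  exact runOn_stages P A

/-- **The output kernel of the chain family is the Born sum of the state after the stages, the event
read through the final swap.** [cite: NielsenChuang2010, §2.2.5 (Born rule), §4.4] -/
theorem kernelProb_family_eq (hT : 0 < Tn P x.length) (E : Set (List Bool)) [DecidablePred (· ∈ E)] :
    (family P).kernelProb A x E = ∑ z : QReg (Wx P x),
      if List.ofFn (z ∘ conjInvol (last_lt P hT)) ∈ E then ‖stateAfter P x A (Tn P x.length) z‖ ^ 2 else 0 := by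
  change ((((circ P x.length).outputPMF A x.get).map List.ofFn).toOuterMeasure E).toReal = _
  rw [toReal_outputPMF_map_ofFn, runOn_circ P A]
  exact sum_ite_normSq_mulVec_of_perm (compInvol (conjInvol (last_lt P hT)) (conjInvol_conjInvol (last_lt P hT)))
    (toMatrix_finalGates_mulVec_basisState P A hT) _ _

end Final

end State

end SeqChain

end Literature.Computability.QuantumComplexity

end
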